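import Literature.NumberTheory.LFunctions.WeilGroundEnergyProofs
import Summits.RiemannHypothesis.RiemannHypothesis.Theorems.SoloInformedQuasiWeilCriterion
import Literature.Analysis.SpecialFunctions.DigammaVerticalAsymptotics
import HarnessLib

/-!
# T41 — the spectral ceiling of negativity (solo-informed, s6)

Bombieri's a-priori bound (Bombieri 2000 §4, Lemma 3: `T[f * f̄*] = (1/2π) ∫ Re ψ(1/4+iv/2)
|f̃(1/2+iv)|² dv + O(M) ‖f‖²`; in the tree `weilQuadratic_re_ge_of_tsupport_subset`, which then
minorises `Re ψ` by `ψ(1/4)`) is recorded here in the one-sided form that KEEPS the archimedean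
integral,

  `Re Q(g) ≥ (1/2π) ∫ |ĝ(1/2+it)|² Re ψ(1/4+it/2) dt − L(a) ‖g‖₂²`     (`weilQuadratic_re_ge_archIntegral`)
  `L(a) := log π + 2 (sinh a − a) + 2 Σ_{n ≤ e^{2a}} Λ(n)/√n`            (`ceilingConst a`)

for every smooth `g` with `tsupport g ⊆ [-a, a]`, together with its consequence, the SPECTRAL
CEILING. Since `t ↦ Re ψ(1/4+it/2)` (`reDigammaQuarter`) is even and increasing in `|t|`
(`reDigammaQuarter_mono`), the step function equal to `ψ(1/4)` on `|t| < |H|` and to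
`W_H := Re ψ(1/4+iH/2)` elsewhere is a minorant, and the minorant principle
(`integral_norm_sq_weilMellin_mul_mono`) with Plancherel `(1/2π) ∫ |ĝ(1/2+it)|² dt = ‖g‖₂²` gives

  `Re Q(g) ≥ (W_H − L(a)) ‖g‖₂² − (W_H − ψ(1/4)) · (1/2π) ∫_{|t| < |H|} |ĝ(1/2+it)|² dt`
                                                                        (`weilQuadratic_re_ge_ceiling`).

Hence a test with `Re Q(g) < 0` carries MORE than the fraction `(W_H − L(a)) / (W_H − ψ(1/4))` of
its spectral mass below height `|H|` (`spectral_mass_below_of_weilQuadratic_neg`), for every `H`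
at once, and conversely a test with at most that fraction below `|H|` has `Re Q(g) ≥ 0`
(`weilQuadratic_re_nonneg_of_spectral_mass_le`); here `W_H ≥ log(1 + |H|/2) − C`
(`exists_log_sub_le_reDigammaQuarter`). Since `L(a) ≤ log π + e^{a} + 8 a e^{a}`
(`ceilingConst_le`), negativity of Weil's form at window `a` is a phenomenon of heights
`exp(O(a e^{a}))`: the fraction of spectral mass that a negative test may keep above height `H`
is `≤ (L(a) − ψ(1/4)) / (W_H − ψ(1/4)) = O(a e^{a} / log H)`.

This is the CEILING of the window ↔ height dictionary of this programme, to be read against its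
FLOORS: any off-line zero of height `≤ e^{c a}` makes `ε(a) < 0` (T40c,
`SoloInformedBlaschkeReach`), and an isolated one does so up to height `exp(e^{(2η − o(1)) a})`
(T39₀, `SoloInformedCompanionZero`). Floor and ceiling agree in shape (`exp(e^{Θ(a)})`).

References: E. Bombieri, *Remarks on Weil's quadratic functional in the theory of prime numbers
I*, Rend. Mat. Acc. Lincei (9) 11 (2000) 183–233, §4 Lemma 3 and (4.3); H. Yoshida, *On Hermitian
forms attached to zeta functions*, Adv. Stud. Pure Math. 21 (1992), §6.
-/

noncomputable section

open Complex Filter Set MeasureTheory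
open scoped Real Topology ComplexConjugate ArithmeticFunction.vonMangoldt

namespace Summit.RiemannHypothesis.RiemannHypothesis.Theorems

open Literature.NumberTheory.LFunctions Literature.Analysis.SpecialFunctions

variable {g : ℝ → ℂ}

/-- The constant `L(a) := log π + 2 (sinh a − a) + 2 Σ_{n ≤ e^{2a}} Λ(n)/√n` of the one-sided
a-priori bound `weilQuadratic_re_ge_archIntegral` (Bombieri 2000 §4 Lemma 3 with explicit
constants: polar term, Yoshida (6.2)–(6.3); prime term, Lemma 2). [cite: Bombieri2000Weil, §4 Lemma 3] -/
def ceilingConst (a : ℝ) : ℝ :=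
  Real.log π + 2 * (Real.sinh a - a) +
    2 * ∑ n ∈ Finset.range (⌊Real.exp (2 * a)⌋₊ + 1), (Λ n : ℝ) / Real.sqrt n

/-- **Bombieri's Lemma 3, one-sided and explicit.** For a smooth `g` with `tsupport g ⊆ [-a, a]`,
`Re Q(g) ≥ (1/2π) ∫ |ĝ(1/2+it)|² Re ψ(1/4+it/2) dt − L(a) ‖g‖₂²`. The proof is the tree's proof
of `weilQuadratic_re_ge_of_tsupport_subset` stopped before `Re ψ ≥ ψ(1/4)` is used. [cite: Bombieri2000Weil, §4 Lemma 3] -/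
theorem weilQuadratic_re_ge_archIntegral (hg : IsWeilTest g) {a : ℝ}
    (hsupp : tsupport g ⊆ Icc (-a) a) :
    1 / (2 * π) * (∫ t : ℝ, ‖weilMellin g (1 / 2 + t * I)‖ ^ 2 * reDigammaQuarter t)
        - ceilingConst a * (∫ t : ℝ, ‖g t‖ ^ 2) ≤ (weilQuadratic g).re := by
  set N2 : ℝ := ∫ t : ℝ, ‖g t‖ ^ 2 with hN2
  set S : ℝ := ∑ n ∈ Finset.range (⌊Real.exp (2 * a)⌋₊ + 1), (Λ n : ℝ) / Real.sqrt n with hS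
  set k : ℝ → ℂ := weilConv g (weilReflect g) with hk
  have hkt : IsWeilTest k := hg.weilConv hg.weilReflect
  have hks : tsupport k ⊆ Icc (-(2 * a)) (2 * a) :=
    tsupport_weilConv_weilReflect_subset hg.2 hsupp
  -- polar term
  have hpol : (weilPolarTerm k).re = 2 * (weilMellin g 0 * conj (weilMellin g 1)).re := by
    rw [hk, weilPolarTerm_weilConv_weilReflect hg, Complex.ofReal_re]
  have hpol_ge : -(2 * (Real.sinh a - a)) * N2 ≤ (weilPolarTerm k).re := by
    rw [hpol]
    exact Yoshida1992_polar_lower_bound hg hsupp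
  -- prime term
  have hprime : (weilPrimeTerm k).re ≤ 2 * N2 * S :=
    (Complex.re_le_norm _).trans
      (norm_weilPrimeTerm_le_of_tsupport_subset hkt.1.continuous hks
        (fun t ↦ norm_weilConv_weilReflect_le hg t))
  -- archimedean term
  set A : ℝ := ∫ t : ℝ, ‖weilMellin g (1 / 2 + t * I)‖ ^ 2 * reDigammaQuarter t with hA
  have harch : (weilArchTerm k).re = 1 / (2 * π) * A - N2 * Real.log π := by
    have e : weilArchTerm k = ((1 / (2 * π) * A - N2 * Real.log π : ℝ) : ℂ) := by
      unfold weilArchTerm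
      rw [hk, weilArchIntegral_weilConv_weilReflect hg, weilConv_weilReflect_apply_zero]
      push_cast
      simp only [hA, reDigammaQuarter]
      ring
    rw [e, Complex.ofReal_re]
  have hQ : (weilQuadratic g).re =
      (weilPolarTerm k).re - (weilPrimeTerm k).re + (weilArchTerm k).re := by
    simp only [weilQuadratic, weilFunctional, hk, Complex.add_re, Complex.sub_re]
  have hL : ceilingConst a * N2 = N2 * Real.log π + 2 * (Real.sinh a - a) * N2 + 2 * N2 * S := by
    simp only [ceilingConst, ← hS]
    ring
  rw [hQ, harch, hL]
  linarith [hpol_ge, hprime]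

/-- Plancherel on the critical line in the local notation: `∫ |ĝ(1/2+it)|² dt = 2π ‖g‖₂²`
(`integral_norm_sq_weilMellin_half_line`). [folklore] -/
theorem integral_norm_sq_weilMellin_eq (hg : IsWeilTest g) :
    ∫ t : ℝ, ‖weilMellin g (1 / 2 + t * I)‖ ^ 2 = 2 * π * ∫ t : ℝ, ‖g t‖ ^ 2 := by
  rw [integral_norm_sq_weilMellin_half_line hg]
  rfl

/-- **The spectral ceiling.** For a smooth `g` with `tsupport g ⊆ [-a, a]` and any height `H`,
`Re Q(g) ≥ (W_H − L(a)) ‖g‖₂² − (W_H − ψ(1/4)) (1/2π) ∫_{|t|<|H|} |ĝ(1/2+it)|² dt` with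
`W_H = Re ψ(1/4 + iH/2)`: the minorant principle for the step minorant of `Re ψ(1/4+it/2)`
(monotone in `|t|`). [cite: Bombieri2000Weil, §4 Lemma 3 and (4.3)] -/
theorem weilQuadratic_re_ge_ceiling (hg : IsWeilTest g) {a : ℝ}
    (hsupp : tsupport g ⊆ Icc (-a) a) (H : ℝ) :
    (reDigammaQuarter H - ceilingConst a) * (∫ t : ℝ, ‖g t‖ ^ 2)
        - (reDigammaQuarter H - reDigammaQuarter 0) *
          (1 / (2 * π) * ∫ t in Ioo (-|H|) |H|, ‖weilMellin g (1 / 2 + t * I)‖ ^ 2) ≤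
      (weilQuadratic g).re := by
  set N2 : ℝ := ∫ t : ℝ, ‖g t‖ ^ 2 with hN2
  set f : ℝ → ℝ := fun t ↦ ‖weilMellin g (1 / 2 + t * I)‖ ^ 2 with hf
  set W : ℝ := reDigammaQuarter H with hW
  set w₀ : ℝ := reDigammaQuarter 0 with hw₀
  set E : Set ℝ := Ioo (-|H|) |H| with hE
  have hEm : MeasurableSet E := measurableSet_Ioo
  -- the step minorant
  set σ : ℝ → ℝ := fun t ↦ W - (W - w₀) * E.indicator (fun _ ↦ (1 : ℝ)) t with hσ
  have hσ_in : ∀ t ∈ E, σ t = w₀ := fun t ht ↦ by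
    simp only [hσ, Set.indicator_of_mem ht]; ring
  have hσ_out : ∀ t ∉ E, σ t = W := fun t ht ↦ by
    simp only [hσ, Set.indicator_of_notMem ht]; ring
  have hσm : Measurable σ :=
    measurable_const.sub (measurable_const.mul (measurable_const.indicator hEm))
  have hw₀W : w₀ ≤ W := reDigammaQuarter_zero_le H
  have hσb : ∀ t, |σ t| ≤ (|W| + |w₀|) + 0 * t ^ 2 := by
    intro t
    rw [zero_mul, add_zero]
    by_cases ht : t ∈ E
    · rw [hσ_in t ht]; linarith [abs_nonneg W]
    · rw [hσ_out t ht]; linarith [abs_nonneg w₀]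
  have hle : ∀ t, σ t ≤ reDigammaQuarter t := by
    intro t
    by_cases ht : t ∈ E
    · rw [hσ_in t ht]; exact reDigammaQuarter_zero_le t
    · rw [hσ_out t ht]
      refine reDigammaQuarter_mono ?_
      simp only [hE, mem_Ioo, not_and_or, not_lt] at ht
      rcases ht with h | h
      · calc |H| ≤ -t := by linarith
          _ ≤ |t| := neg_le_abs t
      · exact h.trans (le_abs_self t)
  have hmono := integral_norm_sq_weilMellin_mul_mono hg hσm (A := |W| + |w₀|) (B := 0)
    (by positivity) le_rfl hσb hle
  -- evaluate `∫ f σ`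
  have hfi : Integrable f := integrable_norm_sq_weilMellin_half_line hg
  have e3 : ∫ t : ℝ, f t = 2 * π * N2 := integral_norm_sq_weilMellin_eq hg
  have heval : ∫ t : ℝ, f t * σ t = W * (2 * π * N2) - (W - w₀) * ∫ t in E, f t := by
    have e1 : (fun t ↦ f t * σ t) = fun t ↦ W * f t - (W - w₀) * E.indicator f t := by
      ext t
      by_cases ht : t ∈ E
      · rw [hσ_in t ht, Set.indicator_of_mem ht]; ring
      · rw [hσ_out t ht, Set.indicator_of_notMem ht]; ring
    rw [e1, integral_sub (hfi.const_mul W) ((hfi.indicator hEm).const_mul _),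
      integral_const_mul, integral_const_mul, integral_indicator hEm, e3]
  have hmono' : W * (2 * π * N2) - (W - w₀) * (∫ t in E, f t) ≤
      ∫ t : ℝ, ‖weilMellin g (1 / 2 + t * I)‖ ^ 2 * reDigammaQuarter t := by
    rw [← heval]; exact hmono
  have hbase := weilQuadratic_re_ge_archIntegral hg hsupp
  have hπ : (0 : ℝ) < 2 * π := by positivity
  have hkey : W * N2 - (W - w₀) * (1 / (2 * π) * ∫ t in E, f t) ≤
      1 / (2 * π) * ∫ t : ℝ, ‖weilMellin g (1 / 2 + t * I)‖ ^ 2 * reDigammaQuarter t := by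
    have e : W * N2 - (W - w₀) * (1 / (2 * π) * ∫ t in E, f t) =
        1 / (2 * π) * (W * (2 * π * N2) - (W - w₀) * ∫ t in E, f t) := by
      field_simp
    rw [e]
    exact mul_le_mul_of_nonneg_left hmono' (by positivity)
  linarith [hbase, hkey]

/-- **Negativity is a low-height phenomenon.** If `Re Q(g) < 0` for a smooth `g` with
`tsupport g ⊆ [-a, a]`, then for every `H` the spectral mass of `g` below height `|H|` exceeds the
fraction `(W_H − L(a)) / (W_H − ψ(1/4))` of the total mass `‖g‖₂² = (1/2π) ∫ |ĝ(1/2+it)|² dt`: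
`(W_H − L(a)) ‖g‖₂² < (W_H − ψ(1/4)) (1/2π) ∫_{|t|<|H|} |ĝ(1/2+it)|² dt`. [cite: Bombieri2000Weil, §4 Lemma 3 and (4.3)] -/
theorem spectral_mass_below_of_weilQuadratic_neg (hg : IsWeilTest g) {a : ℝ}
    (hsupp : tsupport g ⊆ Icc (-a) a) (hneg : (weilQuadratic g).re < 0) (H : ℝ) :
    (reDigammaQuarter H - ceilingConst a) * (∫ t : ℝ, ‖g t‖ ^ 2) <
      (reDigammaQuarter H - reDigammaQuarter 0) *
        (1 / (2 * π) * ∫ t in Ioo (-|H|) |H|, ‖weilMellin g (1 / 2 + t * I)‖ ^ 2) := by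
  have h := weilQuadratic_re_ge_ceiling hg hsupp H
  linarith

/-- The converse reading: if at most the fraction `θ` of the spectral mass of `g` lies below height
`|H|` and `θ (W_H − ψ(1/4)) ≤ W_H − L(a)`, then `Re Q(g) ≥ 0` — tests living above the ceiling
cannot see negativity. [cite: Bombieri2000Weil, §4 Lemma 3 and (4.3)] -/
theorem weilQuadratic_re_nonneg_of_spectral_mass_le (hg : IsWeilTest g) {a θ : ℝ}
    (hsupp : tsupport g ⊆ Icc (-a) a) (H : ℝ)
    (hmass : 1 / (2 * π) * (∫ t in Ioo (-|H|) |H|, ‖weilMellin g (1 / 2 + t * I)‖ ^ 2) ≤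
      θ * ∫ t : ℝ, ‖g t‖ ^ 2)
    (hθ : θ * (reDigammaQuarter H - reDigammaQuarter 0) ≤ reDigammaQuarter H - ceilingConst a) :
    0 ≤ (weilQuadratic g).re := by
  have h := weilQuadratic_re_ge_ceiling hg hsupp H
  have hN2 : 0 ≤ ∫ t : ℝ, ‖g t‖ ^ 2 := integral_nonneg fun t ↦ by positivity
  have hWw : 0 ≤ reDigammaQuarter H - reDigammaQuarter 0 := by
    linarith [reDigammaQuarter_zero_le H]
  have h1 : (reDigammaQuarter H - reDigammaQuarter 0) *
      (1 / (2 * π) * ∫ t in Ioo (-|H|) |H|, ‖weilMellin g (1 / 2 + t * I)‖ ^ 2) ≤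
      (reDigammaQuarter H - reDigammaQuarter 0) * (θ * ∫ t : ℝ, ‖g t‖ ^ 2) :=
    mul_le_mul_of_nonneg_left hmass hWw
  have h2 : (reDigammaQuarter H - reDigammaQuarter 0) * (θ * ∫ t : ℝ, ‖g t‖ ^ 2) ≤
      (reDigammaQuarter H - ceilingConst a) * ∫ t : ℝ, ‖g t‖ ^ 2 := by
    have := mul_le_mul_of_nonneg_right hθ hN2
    linarith
  linarith

/-- The height of the ceiling: `Re ψ(1/4 + iH/2) ≥ log(1 + |H|/2) − C` for an absolute constant
`C` (Bombieri 2000 (4.3), `Re Γ'/Γ(w/2) = log|w| + O(1)`; tree: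
`exists_norm_digamma_sub_log_le_of_pos`). [cite: Bombieri2000Weil, §4 (4.3)] -/
theorem exists_log_sub_le_reDigammaQuarter :
    ∃ C : ℝ, ∀ H : ℝ, Real.log (1 + |H| / 2) - C ≤ reDigammaQuarter H := by
  obtain ⟨C, hC⟩ :=
    Literature.Analysis.SpecialFunctions.Complex.exists_norm_digamma_sub_log_le_of_pos
      (a := 1 / 4) (by norm_num)
  refine ⟨C, fun H ↦ ?_⟩
  have h := hC (H / 2)
  have e : ((1 / 4 : ℝ) : ℂ) + ((H / 2 : ℝ) : ℂ) * I = 1 / 4 + (H : ℂ) / 2 * I := by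
    push_cast; ring
  rw [e, abs_div, abs_two] at h
  have hre := (Complex.abs_re_le_norm (digamma (1 / 4 + (H : ℂ) / 2 * I) -
    (Real.log (1 + |H| / 2) : ℂ))).trans h
  rw [Complex.sub_re, Complex.ofReal_re] at hre
  have : Real.log (1 + |H| / 2) - C ≤ (digamma (1 / 4 + (H : ℂ) / 2 * I)).re := by
    have := (abs_le.1 hre).1
    linarith
  simpa [reDigammaQuarter] using this

/-- The size of the ceiling constant: `L(a) ≤ log π + e^{a} + 8 a e^{a}` for `a > 0`
(`2 (sinh a − a) ≤ e^{a}` and `Σ_{n ≤ e^{2a}} Λ(n)/√n ≤ 4 a e^{a}`, the latter from the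
Chebyshev-free bound `Λ(n) ≤ log n ≤ 2a`, `Σ_{n ≤ N} n^{-1/2} ≤ 2 √N`). So the fraction of
spectral mass a negative test may keep above height `H` is `O(a e^{a} / log H)`. [folklore] -/
theorem ceilingConst_le {a : ℝ} (ha : 0 < a) :
    ceilingConst a ≤ Real.log π + Real.exp a + 8 * a * Real.exp a := by
  have hS := sum_vonMangoldt_div_sqrt_le ha
  have hsinh : 2 * (Real.sinh a - a) ≤ Real.exp a := by
    rw [Real.sinh_eq]
    have := Real.exp_pos (-a)
    linarith
  unfold ceilingConst
  linarith

end Summit.RiemannHypothesis.RiemannHypothesis.Theorems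

end
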